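import Literature.Geometry.Lorentzian.KerrSchildMultiplierCurrent
import Literature.Geometry.Lorentzian.MinkowskiRadialMultiplier
import Summits.FinalStateConjecture.FinalStateConjecture.Theorems.ClusterCompletenessAdiabaticMultiKerrILEDDopplerRay

/-! # Route ClusterCompleteness — crux `AdiabaticMultiKerrILED`: strict inter-hole Doppler red-shift
Helper file for the crux `stmt-FinalStateConjecture-14310` (line `Sketch`, lead c6 wave 2, card
milne-hubble-current): two inertial black holes recede from a common event `O` with unit future
`4`-velocities `u₁`, `u₂` (`η(u, u) = −1`); a photon with null direction `k` leaves hole `1` at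
its proper time `s₁ > 0` and reaches hole `2` at its proper time `s₂ > 0`, `s₂ u₂ = s₁ u₁ + k`.
With the hole-frame energies `Eᵢ = −η(k, uᵢ)` and `E₁ > 0`, the arrival-time law
`s₂² = s₁² + 2 s₁ E₁` forces `s₁ < s₂`, and the conservation law `s₂ E₂ = s₁ E₁` then forces
the strict red-shift `E₂ < E₁`.
[folklore] -/

noncomputable section

-- the doubled `FinalStateConjecture.FinalStateConjecture` path component trips dupNamespace
set_option linter.dupNamespace false

open scoped BigOperators
open Literature.Geometry.Lorentzian

namespace Summit.FinalStateConjecture.FinalStateConjecture.Theorems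

/-- **Strict Doppler red-shift along an inter-hole leg.** Let `u₁`, `u₂` be unit time-like
(`η(uᵢ, uᵢ) = −1`), `k` null, `s₂ u₂ = s₁ u₁ + k` with `s₁, s₂ > 0`, and suppose the emitted
hole-frame energy `E₁ = −η(k, u₁)` is positive. Then the photon arrives strictly later in proper
time, `s₁ < s₂` (from `s₂² = s₁² + 2 s₁ E₁`), and strictly red-shifted, `E₂ = −η(k, u₂) < E₁`
(from `s₂ E₂ = s₁ E₁`, i.e. `E₂ = (s₁ / s₂) E₁`). [folklore] -/
theorem doppler_redshift :
    ∀ (u₁ u₂ k : E4) (s₁ s₂ : ℝ) (hk : Minkowski.bilin k k = 0) (hu₁ : Minkowski.bilin u₁ u₁ = -1)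
      (hu₂ : Minkowski.bilin u₂ u₂ = -1) (h : s₂ • u₂ = s₁ • u₁ + k) (hs₁ : 0 < s₁) (hs₂ : 0 < s₂)
      (hE : 0 < -(Minkowski.bilin k u₁)),
      s₁ < s₂ ∧ -(Minkowski.bilin k u₂) < -(Minkowski.bilin k u₁) := by
  intro u₁ u₂ k s₁ s₂ hk hu₁ hu₂ h hs₁ hs₂ hE
  -- conservation law `s₂ η(k, u₂) = s₁ η(k, u₁)` and arrival-time law `s₂² = s₁² − 2 s₁ η(u₁, k)`
  have hcons := doppler_is_time_ratio u₁ u₂ k s₁ s₂ hk h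
  have harr := arrival_time_sq u₁ u₂ k s₁ s₂ hk hu₁ hu₂ h
  rw [Minkowski.bilin_symm u₁ k] at harr
  -- `s₂² = s₁² + 2 s₁ E₁ > s₁²`, hence `s₁ < s₂` as both are positive
  have hsq : s₁ ^ 2 < s₂ ^ 2 := by
    rw [harr]
    have : 0 < s₁ * -(Minkowski.bilin k u₁) := mul_pos hs₁ hE
    linarith
  have hlt : s₁ < s₂ := lt_of_pow_lt_pow_left₀ 2 hs₂.le hsq
  refine ⟨hlt, ?_⟩
  -- `s₂ E₂ = s₁ E₁ < s₂ E₁`, divide by `s₂ > 0`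
  have hE₁ : s₁ * -(Minkowski.bilin k u₁) < s₂ * -(Minkowski.bilin k u₁) :=
    mul_lt_mul_of_pos_right hlt hE
  have hprod : s₂ * -(Minkowski.bilin k u₂) < s₂ * -(Minkowski.bilin k u₁) := by
    rw [mul_neg, hcons, ← mul_neg]
    exact hE₁
  exact lt_of_mul_lt_mul_left hprod hs₂.le

end Summit.FinalStateConjecture.FinalStateConjecture.Theorems
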